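import Summits.BirchSwinnertonDyer.Rank1Residual.GaloisImage.VisibleLowerBoundThree
import Summits.BirchSwinnertonDyer.Rank1Residual.GaloisImage.NonsplitMultiplicativeUnramifiedSelmer
import HarnessLib

/-!
# The visible lower bound at additive `3` with a FOURTH free kind of place: non-split multiplicative
# facing good (cell `b2b-bsdres`, team n1011, row T-NSK = route planner 1's kind (iv′), ROUTE-1
# §41.9 "PASS⁺"; seat p04 GEN 10; FILE 3 of the row; skeleton `cells/n1011/skel/T-NSK.md`)

HONEST FRAMING (cell `b2b-bsdres`, run/shared/lean/b2b/bsd-rank1-residual/, verbatim in every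
file): the goal of the cell is to DELETE the COMBINATION-SHAPED residual classes of the
Birch–Swinnerton-Dyer formula for ALL analytic-rank `≤ 1` elliptic curves over `ℚ` — "full BSD
formula for every rank `≤ 1` curve in class `C`" assembled STRICTLY from published theorems — so
that the rank-`≤ 1` remainder becomes exactly the CONSTRUCTION-SHAPED classes, which are TYPED
(missing-input `Prop`s), NOT attempted. This is not "finishing BSD". Team n1011 (N10 / N11, the
additive block X4 ∧ `p = 3`): research route on the CONSTRUCTION-SHAPED class X4; no claim beyond
the stated classes; nothing is booked; no mark / label / count is changed by this file. Theorems
only (no definition, no new named fact, no `sorry`). CONDITIONAL on the registered named facts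
A40/A41 (Tate uniformisation, `hU`, `hU2`) and A24 (Cassels–Tate, `hCT`) exactly as the parent file
`VisibleLowerBoundThree.lean`; closes NO class by itself — the per-row certificate (`θ`, the
partner's rank, the local `3`-torsion counts, the reduction types and the non-square test for
`γ = -c₄/c₆` in `ℚ_w`) is an INPUT, EVIDENCE until kernel-certified.

## What

`VisibleLowerBoundThree.lean` §2 `Visible.sq_dvd_card_sha_three_of_congr_of_places` (ℚ, `p = 3`)
pays `#E′(ℚ_w)[3] · #(ℤ_w/3)` at the places of `T` and admits three free kinds off `T`. Route
planner 1's population census (ROUTE-1 §41.3/§41.9) found 895 pair-places where `E` is NON-SPLIT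
multiplicative at `w ≠ 3` and the `3`-congruent partner `E′` has GOOD reduction there with
`#E′(ℚ_w)[3] = 3` — none of the three kinds applies, and paying `3` breaks the budget. FILE 2 of
this row (`NonsplitMultiplicativeUnramifiedSelmer.lean`) proves that such a place is FREE
("kind (iv′)": `θ_* 𝓢_w(E′) ≤ 𝓢_w(E)`, from Milne *ADT* I 3.8 at a non-split place, proved from
the twisted Tate uniformisation). This file is the `K = ℚ`, `p = 3` assembly over FILE 2's
`exists_sha_ne_zero_of_congr_of_places₄`:

* `Visible.sq_dvd_card_sha_three_of_congr_of_places₄` — `3² ∣ #Ш(E)[3^∞]` (hCT) from a refined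
  certificate with the four free kinds;
* `Visible.dvd_shaOrder_three_of_congr_of_places₄` (`3 ∣ #Ш(E)`, no Cassels–Tate) and
  `Visible.missingLowerBoundAt_three_of_congr_of_places₄` — the route's LOWER binder
  `MissingLowerBoundAt W 3` given `#Ш_an = q`, `ord₃ q ≤ 2`.

References: [CremonaMazur2000] §3 and Table 1; [AgasheStein2002] Thm. 3.1; [MilneADT2006] Ch. I
Prop. 3.8; [SilvermanATAEC1994] Ch. V; [SilvermanAEC2009] X.4.14; [Miller2011LMS] Def. 1.1.
-/

noncomputable section

open scoped Classical NumberField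
open Function Field NumberField IsDedekindDomain WeierstrassCurve
open Literature.NumberTheory.EllipticCurves Literature.NumberTheory.EllipticCurves.Rank1Residual
  Literature.NumberTheory.EllipticCurves.Rank1Residual.Typed
  Literature.NumberTheory.GaloisRepresentations

namespace Summit.BirchSwinnertonDyer.Rank1Residual.GaloisImage

namespace Visible

/-- **`Ш(E/ℚ)[3] ≠ 0` from a refined `3`-congruence certificate with FOUR free kinds** (the `K = ℚ`,
`p = 3` instance of `NonsplitKummer.exists_sha_ne_zero_of_congr_of_places₄`): pay
`#E′(ℚ_w)[3] · #(ℤ_w/3)` on `T` (total `< 3^{rank E′}`), and off `T` each place is (i) `w ≠ 3` with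
`E′(ℚ_w)[3] = 0`, (ii) both split multiplicative with `#E(ℚ_w)[3] ≤ 3`, (iii) both multiplicative of
the same twist type with `μ₃(ℚ_w) = 1`, or (iv′) `E` multiplicative with `γ(E) = -c₄/c₆` a non-square
in `ℚ_w` (non-split), `E′` good at `w`, `w ≠ 3`. [cite: CremonaMazur2000, §3 and Table 1]
[cite: MilneADT2006, Ch. I Prop. 3.8] [cite: SilvermanATAEC1994, Ch. V Thm. 3.1, Lemma 5.2, Thm. 5.3, Cor. 5.4] -/
theorem exists_sha_ne_zero_three_of_congr_of_places₄
    (hU : Silverman1994_thmV53_tateUniformisation.{0})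
    (hU2 : Silverman1994_thmV53_corV54_tateUniformisation.{0})
    (W E' : WeierstrassCurve ℚ) [W.IsElliptic] [E'.IsElliptic]
    (θ : geomTorsion E' ((3 : ℕ) : ℤ) ≃+ geomTorsion W ((3 : ℕ) : ℤ))
    (hθ : ∀ (σ : absoluteGaloisGroup ℚ) (P : geomTorsion E' ((3 : ℕ) : ℤ)), θ (σ • P) = σ • θ P)
    (S T : Finset (HeightOneSpectrum (𝓞 ℚ))) (hTS : T ⊆ S)
    (hS : ∀ w : HeightOneSpectrum (𝓞 ℚ), w ∉ S →
      W.HasGoodReductionAt w ∧ E'.HasGoodReductionAt w ∧ ((3 : ℕ) : 𝓞 ℚ) ∉ w.asIdeal)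
    (hfin : Finite W.toAffine.Point) (hcop : (Nat.card W.toAffine.Point).Coprime 3)
    (hT : (∏ w ∈ T, Nat.card (nsmulAddMonoidHom 3 :
        (E'.baseChange (w.adicCompletion ℚ)).toAffine.Point →+ _).ker *
        Nat.card (w.adicCompletionIntegers ℚ ⧸
          Ideal.span {((3 : ℕ) : w.adicCompletionIntegers ℚ)})) < 3 ^ E'.mordellWeilRank)
    (hplaces : ∀ w ∈ S, w ∉ T →
      (((3 : ℕ) : 𝓞 ℚ) ∉ w.asIdeal ∧ Nat.card (nsmulAddMonoidHom 3 :
          (E'.baseChange (w.adicCompletion ℚ)).toAffine.Point →+ _).ker = 1) ∨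
      (W.HasSplitMultiplicativeReductionAt w ∧ E'.HasSplitMultiplicativeReductionAt w ∧
        Nat.card (nsmulAddMonoidHom 3 :
          (W.baseChange (w.adicCompletion ℚ)).toAffine.Point →+ _).ker ≤ 3) ∨
      (W.HasMultiplicativeReductionAt w ∧ E'.HasMultiplicativeReductionAt w ∧
        (∃ r : w.adicCompletion ℚ, algebraMap ℚ (w.adicCompletion ℚ) (-(W.c₄ / W.c₆)) =
          r ^ 2 * algebraMap ℚ (w.adicCompletion ℚ) (-(E'.c₄ / E'.c₆))) ∧
        (∀ ζ : w.adicCompletion ℚ, ζ ^ 3 = 1 → ζ = 1)) ∨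
      (W.HasMultiplicativeReductionAt w ∧
        ¬ IsSquare (algebraMap ℚ (w.adicCompletion ℚ) (-(W.c₄ / W.c₆))) ∧
        E'.HasGoodReductionAt w ∧ ((3 : ℕ) : 𝓞 ℚ) ∉ w.asIdeal)) :
    ∃ c : W.sha, c ≠ 0 ∧ 3 • c = 0 := by
  haveI : Fact (Nat.Prime 3) := ⟨Nat.prime_three⟩
  exact NonsplitKummer.exists_sha_ne_zero_of_congr_of_places₄ W hU hU2 (by norm_num) E' θ hθ S T
    hTS hS hfin hcop hT hplaces

/-- **The visible lower bound at additive `3` with FOUR free kinds**: `3² ∣ #Ш(E)[3^∞]` for `Ш(E)`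
finite (Cassels–Tate parity, `hCT`) from the refined certificate of
`exists_sha_ne_zero_three_of_congr_of_places₄` — route planner 1's PASS⁺ record shape (ROUTE-1
§41.9: kind (iv′) = `E` non-split multiplicative facing a good partner at `w ≠ 3`).
[cite: CremonaMazur2000, §3 and Table 1] [cite: SilvermanAEC2009, Thm. X.4.14]
[cite: MilneADT2006, Ch. I Prop. 3.8] -/
theorem sq_dvd_card_sha_three_of_congr_of_places₄
    (hU : Silverman1994_thmV53_tateUniformisation.{0})
    (hU2 : Silverman1994_thmV53_corV54_tateUniformisation.{0})
    (hCT : exists_casselsTate_pairing (K := ℚ))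
    (W E' : WeierstrassCurve ℚ) [W.IsElliptic] [E'.IsElliptic] [Finite W.sha]
    (θ : geomTorsion E' ((3 : ℕ) : ℤ) ≃+ geomTorsion W ((3 : ℕ) : ℤ))
    (hθ : ∀ (σ : absoluteGaloisGroup ℚ) (P : geomTorsion E' ((3 : ℕ) : ℤ)), θ (σ • P) = σ • θ P)
    (S T : Finset (HeightOneSpectrum (𝓞 ℚ))) (hTS : T ⊆ S)
    (hS : ∀ w : HeightOneSpectrum (𝓞 ℚ), w ∉ S →
      W.HasGoodReductionAt w ∧ E'.HasGoodReductionAt w ∧ ((3 : ℕ) : 𝓞 ℚ) ∉ w.asIdeal)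
    (hfin : Finite W.toAffine.Point) (hcop : (Nat.card W.toAffine.Point).Coprime 3)
    (hT : (∏ w ∈ T, Nat.card (nsmulAddMonoidHom 3 :
        (E'.baseChange (w.adicCompletion ℚ)).toAffine.Point →+ _).ker *
        Nat.card (w.adicCompletionIntegers ℚ ⧸
          Ideal.span {((3 : ℕ) : w.adicCompletionIntegers ℚ)})) < 3 ^ E'.mordellWeilRank)
    (hplaces : ∀ w ∈ S, w ∉ T →
      (((3 : ℕ) : 𝓞 ℚ) ∉ w.asIdeal ∧ Nat.card (nsmulAddMonoidHom 3 :
          (E'.baseChange (w.adicCompletion ℚ)).toAffine.Point →+ _).ker = 1) ∨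
      (W.HasSplitMultiplicativeReductionAt w ∧ E'.HasSplitMultiplicativeReductionAt w ∧
        Nat.card (nsmulAddMonoidHom 3 :
          (W.baseChange (w.adicCompletion ℚ)).toAffine.Point →+ _).ker ≤ 3) ∨
      (W.HasMultiplicativeReductionAt w ∧ E'.HasMultiplicativeReductionAt w ∧
        (∃ r : w.adicCompletion ℚ, algebraMap ℚ (w.adicCompletion ℚ) (-(W.c₄ / W.c₆)) =
          r ^ 2 * algebraMap ℚ (w.adicCompletion ℚ) (-(E'.c₄ / E'.c₆))) ∧
        (∀ ζ : w.adicCompletion ℚ, ζ ^ 3 = 1 → ζ = 1)) ∨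
      (W.HasMultiplicativeReductionAt w ∧
        ¬ IsSquare (algebraMap ℚ (w.adicCompletion ℚ) (-(W.c₄ / W.c₆))) ∧
        E'.HasGoodReductionAt w ∧ ((3 : ℕ) : 𝓞 ℚ) ∉ w.asIdeal)) :
    3 ^ 2 ∣ Nat.card (AddCommGroup.primaryComponent W.sha 3) :=
  sq_dvd_card_sha_three_of_exists_sha_torsion hCT W
    (exists_sha_ne_zero_three_of_congr_of_places₄ hU hU2 W E' θ hθ S T hTS hS hfin hcop hT hplaces)

/-- **`3 ∣ #Ш(E)` from the four-kind certificate** (no Cassels–Tate, no finiteness of `Ш`: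
`#Ш := Nat.card`; `Typed.dvd_shaOrder_of_exists_torsion`). [cite: CremonaMazur2000, §3 and Table 1] -/
theorem dvd_shaOrder_three_of_congr_of_places₄
    (hU : Silverman1994_thmV53_tateUniformisation.{0})
    (hU2 : Silverman1994_thmV53_corV54_tateUniformisation.{0})
    (W E' : WeierstrassCurve ℚ) [W.IsElliptic] [E'.IsElliptic]
    (θ : geomTorsion E' ((3 : ℕ) : ℤ) ≃+ geomTorsion W ((3 : ℕ) : ℤ))
    (hθ : ∀ (σ : absoluteGaloisGroup ℚ) (P : geomTorsion E' ((3 : ℕ) : ℤ)), θ (σ • P) = σ • θ P)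
    (S T : Finset (HeightOneSpectrum (𝓞 ℚ))) (hTS : T ⊆ S)
    (hS : ∀ w : HeightOneSpectrum (𝓞 ℚ), w ∉ S →
      W.HasGoodReductionAt w ∧ E'.HasGoodReductionAt w ∧ ((3 : ℕ) : 𝓞 ℚ) ∉ w.asIdeal)
    (hfin : Finite W.toAffine.Point) (hcop : (Nat.card W.toAffine.Point).Coprime 3)
    (hT : (∏ w ∈ T, Nat.card (nsmulAddMonoidHom 3 :
        (E'.baseChange (w.adicCompletion ℚ)).toAffine.Point →+ _).ker *
        Nat.card (w.adicCompletionIntegers ℚ ⧸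
          Ideal.span {((3 : ℕ) : w.adicCompletionIntegers ℚ)})) < 3 ^ E'.mordellWeilRank)
    (hplaces : ∀ w ∈ S, w ∉ T →
      (((3 : ℕ) : 𝓞 ℚ) ∉ w.asIdeal ∧ Nat.card (nsmulAddMonoidHom 3 :
          (E'.baseChange (w.adicCompletion ℚ)).toAffine.Point →+ _).ker = 1) ∨
      (W.HasSplitMultiplicativeReductionAt w ∧ E'.HasSplitMultiplicativeReductionAt w ∧
        Nat.card (nsmulAddMonoidHom 3 :
          (W.baseChange (w.adicCompletion ℚ)).toAffine.Point →+ _).ker ≤ 3) ∨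
      (W.HasMultiplicativeReductionAt w ∧ E'.HasMultiplicativeReductionAt w ∧
        (∃ r : w.adicCompletion ℚ, algebraMap ℚ (w.adicCompletion ℚ) (-(W.c₄ / W.c₆)) =
          r ^ 2 * algebraMap ℚ (w.adicCompletion ℚ) (-(E'.c₄ / E'.c₆))) ∧
        (∀ ζ : w.adicCompletion ℚ, ζ ^ 3 = 1 → ζ = 1)) ∨
      (W.HasMultiplicativeReductionAt w ∧
        ¬ IsSquare (algebraMap ℚ (w.adicCompletion ℚ) (-(W.c₄ / W.c₆))) ∧
        E'.HasGoodReductionAt w ∧ ((3 : ℕ) : 𝓞 ℚ) ∉ w.asIdeal)) :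
    3 ∣ W.shaOrder := by
  haveI : Fact (Nat.Prime 3) := ⟨Nat.prime_three⟩
  exact Typed.dvd_shaOrder_of_exists_torsion W 3
    (exists_sha_ne_zero_three_of_congr_of_places₄ hU hU2 W E' θ hθ S T hTS hS hfin hcop hT hplaces)

/-- **The route's LOWER binder from a four-kind congruence certificate**: `MissingLowerBoundAt W 3`
for a globally minimal `E = W` with `Ш(E)` finite, `#Ш(E)_an = q` rational with `ord₃ q ≤ 2`
(`3 ∣ #Ш` from the certificate and `#Ш` a square, Cassels–Tate; as
`missingLowerBoundAt_three_of_congr_of_rank`). [cite: Miller2011LMS, §1 and Def. 1.1]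
[cite: SilvermanAEC2009, Thm. X.4.14] [cite: CremonaMazur2000, §3 and Table 1] -/
theorem missingLowerBoundAt_three_of_congr_of_places₄
    (hU : Silverman1994_thmV53_tateUniformisation.{0})
    (hU2 : Silverman1994_thmV53_corV54_tateUniformisation.{0})
    (hCT : exists_casselsTate_pairing (K := ℚ))
    (W E' : WeierstrassCurve ℚ) [W.IsElliptic] [W.IsGloballyMinimal] [E'.IsElliptic]
    (θ : geomTorsion E' ((3 : ℕ) : ℤ) ≃+ geomTorsion W ((3 : ℕ) : ℤ))
    (hθ : ∀ (σ : absoluteGaloisGroup ℚ) (P : geomTorsion E' ((3 : ℕ) : ℤ)), θ (σ • P) = σ • θ P)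
    (S T : Finset (HeightOneSpectrum (𝓞 ℚ))) (hTS : T ⊆ S)
    (hS : ∀ w : HeightOneSpectrum (𝓞 ℚ), w ∉ S →
      W.HasGoodReductionAt w ∧ E'.HasGoodReductionAt w ∧ ((3 : ℕ) : 𝓞 ℚ) ∉ w.asIdeal)
    (hfin : Finite W.toAffine.Point) (hcop : (Nat.card W.toAffine.Point).Coprime 3)
    (hT : (∏ w ∈ T, Nat.card (nsmulAddMonoidHom 3 :
        (E'.baseChange (w.adicCompletion ℚ)).toAffine.Point →+ _).ker *
        Nat.card (w.adicCompletionIntegers ℚ ⧸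
          Ideal.span {((3 : ℕ) : w.adicCompletionIntegers ℚ)})) < 3 ^ E'.mordellWeilRank)
    (hplaces : ∀ w ∈ S, w ∉ T →
      (((3 : ℕ) : 𝓞 ℚ) ∉ w.asIdeal ∧ Nat.card (nsmulAddMonoidHom 3 :
          (E'.baseChange (w.adicCompletion ℚ)).toAffine.Point →+ _).ker = 1) ∨
      (W.HasSplitMultiplicativeReductionAt w ∧ E'.HasSplitMultiplicativeReductionAt w ∧
        Nat.card (nsmulAddMonoidHom 3 :
          (W.baseChange (w.adicCompletion ℚ)).toAffine.Point →+ _).ker ≤ 3) ∨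
      (W.HasMultiplicativeReductionAt w ∧ E'.HasMultiplicativeReductionAt w ∧
        (∃ r : w.adicCompletion ℚ, algebraMap ℚ (w.adicCompletion ℚ) (-(W.c₄ / W.c₆)) =
          r ^ 2 * algebraMap ℚ (w.adicCompletion ℚ) (-(E'.c₄ / E'.c₆))) ∧
        (∀ ζ : w.adicCompletion ℚ, ζ ^ 3 = 1 → ζ = 1)) ∨
      (W.HasMultiplicativeReductionAt w ∧
        ¬ IsSquare (algebraMap ℚ (w.adicCompletion ℚ) (-(W.c₄ / W.c₆))) ∧
        E'.HasGoodReductionAt w ∧ ((3 : ℕ) : 𝓞 ℚ) ∉ w.asIdeal))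
    (hSha : W.ShaFinite) {q : ℚ} (hq : shaAn W = (q : ℂ)) (hv : padicValRat 3 q ≤ 2) :
    MissingLowerBoundAt W 3 := by
  haveI : Fact (Nat.Prime 3) := ⟨Nat.prime_three⟩
  refine Typed.missingLowerBoundAt_of_casselsTate_of_pow_dvd W 3 hCT hSha hq (k := 1)
    (by simpa using hv) ?_
  simpa using dvd_shaOrder_three_of_congr_of_places₄ hU hU2 W E' θ hθ S T hTS hS hfin hcop hT
    hplaces

end Visible

end Summit.BirchSwinnertonDyer.Rank1Residual.GaloisImage

end
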